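import Literature.Algebra.EuclideanLattices.DualGridQueryUniformity
import Literature.Algebra.EuclideanLattices.MRIncGDDIdealised
import Literature.Computability.Cryptography.IncGDDToSISAnalysis
import HarnessLib

/-!
# One attempt of MR07 Thm. 5.9 on the integer fine grid, idealised: the experiment and its success probability — proved

Topic `Algebra/EuclideanLattices` (family `pqc`). The analogue, for the bit-level model of
`DualGridCosetModel`/`DualGridAttemptSpec`/`DualGridQueryGroup`/`DualGridQueryUniformity`
(lattice `Λ = G ℤⁿ = det(B)²·L(B)*`, fine grid `L' = (1/N)ℤⁿ`, coin boxes for the `v`-randomness),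
of `MRIncGDDIdealised.lean` (which does the same on the skewed grid `L(S)/M` with exactly uniform
lattice classes): ONE ATTEMPT of the reduction of Micciancio–Regev 2007, Thm. 5.9 (authors' version
pp. 22–24) for a fixed guess, written as a `PMF` experiment with EXACT discrete Gaussians
`D_{(1/N)ℤⁿ,s,tᵢ}` for the sampling procedure (Lemma 5.7) and an arbitrary oracle kernel `O`, and
its success probability bounded below as printed:

  `Pr[u ∈ Λ ∧ ‖u − t‖ ≤ n√m β σ/q + r] ≥ (δ_{j,α} − m·(2ε/(1+ε) + n·dT/2^ℓ + n·q/N)) / 3`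

(`toReal_experimentD_success_ge`). The three slack terms: Lemma 5.7 first claim on the grid
(`tvDist_gridSample_fst_le`), the non-uniform kernel part and the rounding when `q ∤ N`
(`DualGridQueryUniformity.tvDist_queryMatrix_uniform_le`). Ingredients as in the printed proof: the
skeleton `PMF.mul_sub_tvDist_le_toReal_experiment`, Lemma 5.8 (ii)/(iii) for the attempt
(`DualGridAttemptSpec.norm_xVec_sub_le`), and the conditional `2/3` bound (`MRIncGDDSuccessPMF`).

* Definitions (with bodies): `floOf`/`cwOf`/`AzOf`/`xVecOf` (the attempt's integer formulas as
  functions of the offset representatives; `xVec_eq_xVecOf`), `offsetLawD`, `condLawD`,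
  `queryMatrixD`, `experimentD`, `outputD`.
* `bind_pure_queryMatrixD_eq`, `tvDist_queryD_le` — law of the query and its distance from uniform;
* `cond_success_geD` — conditional success `≥ 1/3`; `toReal_experimentD_success_ge` — the bound.

## References

* D. Micciancio, O. Regev, *Worst-case to average-case reductions based on Gaussian measures*,
  SIAM J. Comput. 37 (2007) 267–302; authors' version, Thm. 5.9 and its proof (pp. 22–24),
  Lemmas 5.7–5.8 (pp. 20–21).
-/

noncomputable section

open scoped Classical ENNReal Real

namespace Literature.Algebra.EuclideanLattices

open Module Submodule Matrix GSInverse Finset Literature.Probability.Distributions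
  Literature.InformationTheory.Coding PMF MeasureTheory

namespace DualGrid

variable {n : ℕ} (B : Matrix (Fin n) (Fin n) ℤ) (N : ℕ) (S : Fin n → Fin n → ℤ)

/-! ### The attempt's formulas as functions of the offset representatives -/

/-- `⌊σⱼ⌋` from a representative `C`. [folklore] -/
def floOf (C κ : Fin n → ℤ) (j : Fin n) : ℤ := VnumOf B N S C κ j / modM B N S

/-- `c - w = -G κ + ∑ⱼ ⌊σⱼ⌋ sⱼ` from a representative `C`. [cite: MicciancioRegev2007, Lemma 5.8 (ii)] -/
def cwOf (C κ : Fin n → ℤ) : Fin n → ℤ := -(G B *ᵥ κ) + ∑ j, floOf B N S C κ j • S j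

variable {m : ℕ}

/-- `(A z)ⱼ` from representatives. [cite: MicciancioRegev2007, Lemma 5.8 (step 5)] -/
def AzOf (q : ℕ) (Cf κf : Fin m → Fin n → ℤ) (z : Fin m → ℤ) (j : Fin n) : ℤ :=
  ∑ i, z i * aEntOf B N S q (Cf i) (κf i) j

/-- `x` from representatives. [cite: MicciancioRegev2007, Lemma 5.8 (step 5)] -/
def xVecOf (q : ℕ) (Cf κf : Fin m → Fin n → ℤ) (z : Fin m → ℤ) : Fin n → ℤ :=
  ∑ i, z i • cwOf B N S (Cf i) (κf i) + ∑ j, (AzOf B N S q Cf κf z j / q) • S j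

/-- The machine's `x` depends on the noise `Kᵢ` only through `crep Kᵢ`. [folklore] -/
theorem xVec_eq_xVecOf (q : ℕ) (Kf κf : Fin m → Fin n → ℤ) (z : Fin m → ℤ) :
    xVec B N S q Kf κf z = xVecOf B N S q (fun i => crep B N (Kf i)) κf z := rfl

/-- `AzOf` from representatives is `Az`. [folklore] -/
theorem Az_eq_AzOf (q : ℕ) (Kf κf : Fin m → Fin n → ℤ) (z : Fin m → ℤ) :
    Az B N S q Kf κf z = AzOf B N S q (fun i => crep B N (Kf i)) κf z := rfl

/-! ### The lattice `Λ` on the `dualLat` spelling -/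

variable {B} in
/-- `Λ = G ℤⁿ` is a nonsingular lattice instance. [folklore] -/
theorem dualInst_isNonsingular (hB : B.det ≠ 0) : (dualInst B).IsNonsingular := by
  rw [LatticeInstance.isNonsingular_iff]
  show ((G B).transpose).det ≠ 0
  rw [Matrix.det_transpose]
  exact det_G_ne_zero hB

/-- `Λ` is discrete (instance on the `dualLat` spelling). [folklore] -/
instance instDiscreteTopologyDualLat : DiscreteTopology (dualLat B) :=
  LatticeInstance.instDiscreteTopologyLattice (dualInst B)

variable {B} in
/-- `Λ` is a full-rank lattice (on the `dualLat` spelling; use `haveI`). [folklore] -/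
theorem isZLattice_dualLat (hB : B.det ≠ 0) : IsZLattice ℝ (dualLat B) :=
  LatticeInstance.isZLattice_of_isNonsingular (dualInst_isNonsingular hB)

/-! ### The idealised attempt -/

variable [NeZero N]

/-- **The law of the offset class `cᵢ`** of one run of the sampling procedure on the integer fine
grid: noise `r ∼ D_{(1/N)ℤⁿ, s, T/N}`, class `c = φ(-r)`. [cite: MicciancioRegev2007, Lemma 5.7 with Thm. 5.9 (step 2)] -/
def offsetLawD (hB : B.det ≠ 0) (s : ℝ) (T : Fin n → ℤ) : PMF (Grp B N) :=
  ((discreteGaussian (fineGrid n N) s (fineGridVec n N T)).map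
    (MicciancioRegev2007.gridSample (phi B N) (hker hB) (rep B N) (phi_rep hB))).map Prod.fst

/-- **The conditional law of the lattice vectors given the classes**: independent
`yᵢ ∼ D_{Λ, s, tᵢ + rep cᵢ}`. [cite: MicciancioRegev2007, Lemma 5.7 (second claim)] -/
def condLawD (s : ℝ) (Tsh : Fin m → Fin n → ℤ) (c : Fin m → Grp B N) : PMF (Fin m → dualLat B) :=
  indepLaw m fun i => discreteGaussian (dualLat B) s (fineGridVec n N (Tsh i) + ((rep B N (c i) : fineGrid n N) : EuclideanSpace ℝ (Fin n)))

/-- **The query matrix** from classes and box vectors (column `i` = query of sample `i`). [cite: MicciancioRegev2007, Lemma 5.8 (step 3)] -/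
def queryMatrixD (q : ℕ) (c : Fin m → Grp B N) (κ : Fin m → Fin n → ℤ) : Matrix (Fin n) (Fin m) (ZMod q) :=
  Matrix.of fun j i => ((aEntOf B N S q (crepInt B N (c i)) (κ i) j : ℤ) : ZMod q)

/-- **One idealised attempt as a random experiment** with values `(((c, κ), (A, z)), y)`: classes
`cᵢ ∼ offsetLawD` and coin boxes `κᵢ` (first stage), then — conditionally independent — the lattice
vectors `y ∼ condLawD c` and (query `A = queryMatrixD c κ`, answer `z ∼ O A`).
[cite: MicciancioRegev2007, Thm. 5.9 (proof, pp. 22–23)] -/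
def experimentD {q : ℕ} (hB : B.det ≠ 0) (O : Matrix (Fin n) (Fin m) (ZMod q) → PMF (Fin m → ℤ)) (s : ℝ)
    (Tsh : Fin m → Fin n → ℤ) (ℓ : ℕ) :
    PMF ((((Fin m → Grp B N) × (Fin m → Fin n → ℤ)) × (Matrix (Fin n) (Fin m) (ZMod q) × (Fin m → ℤ))) ×
      (Fin m → dualLat B)) :=
  (((indepLaw m fun i => offsetLawD B N hB s (Tsh i)).bind fun c =>
      (indepLaw m fun _ => boxLaw n ℓ).map (Prod.mk c)).bind fun ch =>
    (condLawD B N s Tsh ch.1).bind fun y =>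
      ((PMF.pure (queryMatrixD B N S q ch.1 ch.2)).bind fun A => (O A).map (Prod.mk A)).map fun az => ((ch, az), y))

/-- **The output `u = x − ∑ zᵢ yᵢ`** read off a value of `experimentD`. [cite: MicciancioRegev2007, Thm. 5.9 (step 4)] -/
def outputD (q : ℕ) (ω : (((Fin m → Grp B N) × (Fin m → Fin n → ℤ)) × (Matrix (Fin n) (Fin m) (ZMod q) × (Fin m → ℤ))) ×
      (Fin m → dualLat B)) : EuclideanSpace ℝ (Fin n) :=
  intVecToEuclidean n (xVecOf B N S q (fun i => crepInt B N (ω.1.1.1 i)) ω.1.1.2 ω.1.2.2) -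
    ∑ i, (ω.1.2.2 i : ℝ) • ((ω.2 i : dualLat B) : EuclideanSpace ℝ (Fin n))

variable {B N S}

/-! ### Generalities on `Λ` -/

/-- `Λ ⊆ (1/N)ℤⁿ`. [folklore] -/
theorem dualLat_le_fineGrid : dualLat B ≤ fineGrid n N :=
  (dualInst B).lattice_le_stdIntLattice.trans (stdIntLattice_le_invScaledIntLattice n N)

/-- `rep c = crepInt c / N` as a vector of `ℝⁿ`. [folklore] -/
theorem coe_rep_eq (c : Grp B N) :
    ((rep B N c : fineGrid n N) : EuclideanSpace ℝ (Fin n)) = (N : ℝ)⁻¹ • intVecToEuclidean n (crepInt B N c) := by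
  rw [rep_eq_fineGridEquiv_crepInt, coe_fineGridEquiv, fineGridVec]

omit [NeZero N] in
/-- `crep (-liftVec c) = crepInt c`. [folklore] -/
theorem crep_neg_liftVec (c : Grp B N) : crep B N (-liftVec B N c) = crepInt B N c := by
  rw [crep, neg_neg, crepInt]

/-! ### The law of the query -/

section Query

variable (hB : B.det ≠ 0) (hS : ∀ j, intVecToEuclidean n (S j) ∈ dualLat B)
  (hli : LinearIndependent ℝ fun j => intVecToEuclidean n (S j)) [NeZero (MM B N S)] [NeZero (Mo B N)]

include hS hli

omit [NeZero (MM B N S)] [NeZero (Mo B N)] hS hli [NeZero N] in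
/-- The query stage as a product of columns: `(c, κ) ↦ A` pushed through the first stage is the
column-product law of `DualGridQueryUniformity`, transposed. [folklore] -/
theorem bind_pure_queryMatrixD_eq (q : ℕ) (μ : Fin m → PMF (Grp B N)) (ℓ : ℕ) :
    (((indepLaw m μ).bind fun c => (indepLaw m fun _ => boxLaw n ℓ).map (Prod.mk c)).bind fun ch =>
        PMF.pure (queryMatrixD B N S q ch.1 ch.2)) =
      (indepLaw m fun i => (μ i).bind fun c => (boxLaw n ℓ).map fun κ => fun j =>
          ((aEntOf B N S q (crepInt B N c) κ j : ℤ) : ZMod q)).map fun A => Matrix.of fun j i => A i j := by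
  rw [← indepLaw_bind_indepLaw_map m μ (fun _ => boxLaw n ℓ)
    (fun _ c κ => fun j => ((aEntOf B N S q (crepInt B N c) κ j : ℤ) : ZMod q)), PMF.map_bind, PMF.bind_bind]
  refine congrArg (indepLaw m μ).bind (funext fun c => ?_)
  rw [PMF.bind_map, PMF.map_comp]
  change ((indepLaw m fun _ => boxLaw n ℓ).bind (PMF.pure ∘ fun κ => queryMatrixD B N S q c κ)) = _
  rw [PMF.bind_pure_comp]
  rfl

/-- **Eq. (13) with Lemma 5.8 (i) for the attempt**: the query is within
`m·(2ε/(1+ε) + n·dT/2^ℓ + n·q/N)` of uniform (`η_ε(Λ) ≤ s`, `1 ≤ q ≤ N`).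
[cite: MicciancioRegev2007, Thm. 5.9 eq. (13) and Lemma 5.8 (i)] -/
theorem tvDist_queryD_le {q : ℕ} [NeZero q] (hqN : q ≤ N) {ε s : ℝ} (hε : 0 < ε) (hs : 0 < s)
    (hηs : smoothingParameter (dualLat B) ε ≤ s) (Tsh : Fin m → Fin n → ℤ) (ℓ : ℕ) :
    ((((indepLaw m fun i => offsetLawD B N hB s (Tsh i)).bind fun c =>
        (indepLaw m fun _ => boxLaw n ℓ).map (Prod.mk c)).bind fun ch =>
        PMF.pure (queryMatrixD B N S q ch.1 ch.2)).tvDist (PMF.uniformOfFintype (Matrix (Fin n) (Fin m) (ZMod q)))) ≤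
      m * (2 * ε / (1 + ε) + n * (((dT B S).toNat : ℝ) / 2 ^ ℓ) + n * ((q : ℝ) / N)) := by
  haveI := isZLattice_dualLat hB
  rw [bind_pure_queryMatrixD_eq]
  refine (tvDist_queryMatrix_uniform_le hB hS hli hqN m _ ℓ).trans ?_
  have hc : ∀ i, (offsetLawD B N hB s (Tsh i)).tvDist (PMF.uniformOfFintype (Grp B N)) ≤ 2 * ε / (1 + ε) := fun i =>
    MicciancioRegev2007.tvDist_gridSample_fst_le dualLat_le_fineGrid (phi B N) (phi_surjective hB) (hker hB)
      (rep B N) (phi_rep hB) hε hs hηs _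
  calc ∑ i, ((offsetLawD B N hB s (Tsh i)).tvDist (PMF.uniformOfFintype (Grp B N)) +
        n * (((dT B S).toNat : ℝ) / 2 ^ ℓ) + n * ((q : ℝ) / N))
      ≤ ∑ _i : Fin m, (2 * ε / (1 + ε) + n * (((dT B S).toNat : ℝ) / 2 ^ ℓ) + n * ((q : ℝ) / N)) :=
        Finset.sum_le_sum fun i _ => by linarith [hc i]
    _ = m * (2 * ε / (1 + ε) + n * (((dT B S).toNat : ℝ) / 2 ^ ℓ) + n * ((q : ℝ) / N)) := by
        rw [Finset.sum_const, Finset.card_univ, Fintype.card_fin, nsmul_eq_mul]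

end Query

/-! ### The conditional success given the first stage and a good answer -/

section Cond

variable (hB : B.det ≠ 0) (hS : ∀ j, intVecToEuclidean n (S j) ∈ dualLat B)
  (hli : LinearIndependent ℝ fun j => intVecToEuclidean n (S j))

include hB hS hli

omit hB hS hli [NeZero N] in
/-- **`A z ≡ 0 (mod q)` for the true query gives the divisibility hypothesis of Lemma 5.8 (ii).** [cite: MicciancioRegev2007, Lemma 5.8 (ii)] -/
theorem dvd_AzOf_of_mulVec_eq_zero {q : ℕ} (c : Fin m → Grp B N) (κ : Fin m → Fin n → ℤ) {z : Fin m → ℤ}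
    (hAz : (queryMatrixD B N S q c κ).mulVec (fun i => (z i : ZMod q)) = 0) (j : Fin n) :
    (q : ℤ) ∣ AzOf B N S q (fun i => crepInt B N (c i)) κ z j := by
  have h : ∑ i, (((aEntOf B N S q (crepInt B N (c i)) (κ i) j : ℤ) : ZMod q)) * (z i : ZMod q) = 0 := congrFun hAz j
  rw [← ZMod.intCast_zmod_eq_zero_iff_dvd, AzOf, Int.cast_sum, ← h]
  exact Finset.sum_congr rfl fun i _ => by rw [Int.cast_mul, mul_comm]

omit hB hS hli in
/-- `‖z‖ ≤ β` from `∑ zᵢ² ≤ β²`. [folklore] -/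
theorem norm_intVec_le_of_sum_sq_le {z : Fin m → ℤ} {β : ℝ} (hβ : 0 < β) (hz : ∑ i, (z i : ℝ) ^ 2 ≤ β ^ 2) :
    ‖intVecToEuclidean m z‖ ≤ β := by
  rw [norm_intVecToEuclidean]
  calc Real.sqrt (∑ j, (z j : ℝ) ^ 2) ≤ Real.sqrt (β ^ 2) := Real.sqrt_le_sqrt hz
    _ = β := Real.sqrt_sq hβ.le

/-- **MR07 Thm. 5.9 — success `≥ 1/3` conditioned on the first stage and a good answer for the true
query** (p. 23). Parameters: `0 < ε < 1`, `s = 2r/(β√n) ≥ 2η_ε(Λ)`, `‖sⱼ‖ ≤ σ`, `∑ zᵢ tᵢ = −t` when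
`z_{j₀} = α`, side condition `1/(2π) + ε/(1−ε) + (ε/(1−ε))² m ≤ 1/6`.
[cite: MicciancioRegev2007, Thm. 5.9 (proof, pp. 23–24)] -/
theorem cond_success_geD {q : ℕ} (hq : 0 < q) {ε β r σ : ℝ} (hε : 0 < ε) (hε1 : ε < 1) (hβ : 0 < β) (hr : 0 < r)
    (hn : 1 ≤ n) (hηs : 2 * smoothingParameter (dualLat B) ε ≤ 2 * r / (β * Real.sqrt n))
    (hσ : ∀ j, ‖intVecToEuclidean n (S j)‖ ≤ σ) (Tsh : Fin m → Fin n → ℤ) (t : EuclideanSpace ℝ (Fin n))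
    (j₀ : Fin m) (α : ℤ) (htv : ∀ z : Fin m → ℤ, z j₀ = α → ∑ i, (z i : ℝ) • fineGridVec n N (Tsh i) = -t)
    (hnum : 1 / (2 * π) + ε / (1 - ε) + (ε / (1 - ε)) ^ 2 * m ≤ 1 / 6)
    (ch : (Fin m → Grp B N) × (Fin m → Fin n → ℤ)) (az : Matrix (Fin n) (Fin m) (ZMod q) × (Fin m → ℤ))
    (haz : az.1.mulVec (fun i => (az.2 i : ZMod q)) = 0 ∧ ∑ i, (az.2 i : ℝ) ^ 2 ≤ β ^ 2 ∧ az.2 j₀ = α) :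
    (1 / 3 : ℝ) ≤ ((condLawD B N (2 * r / (β * Real.sqrt n)) Tsh ch.1).toOuterMeasure
        {y | az.1 = queryMatrixD B N S q ch.1 ch.2 →
          (outputD B N S q ((ch, az), y) ∈ dualLat B ∧
            ‖outputD B N S q ((ch, az), y) - t‖ ≤ n * Real.sqrt m * β * σ / q + r)}).toReal := by
  haveI := isZLattice_dualLat hB
  obtain ⟨c, κ⟩ := ch
  obtain ⟨A, z⟩ := az
  obtain ⟨hAz, hz, hzj⟩ := haz
  dsimp only at hAz hz hzj ⊢
  have hfin : finrank ℝ (EuclideanSpace ℝ (Fin n)) = n := finrank_euclideanSpace_fin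
  by_cases hA : A = queryMatrixD B N S q c κ
  · subst hA
    set Kf : Fin m → Fin n → ℤ := fun i => -liftVec B N (c i) with hKf
    have hcrep : ∀ i, crep B N (Kf i) = crepInt B N (c i) := fun i => crep_neg_liftVec (c i)
    set x : EuclideanSpace ℝ (Fin n) := intVecToEuclidean n (xVecOf B N S q (fun i => crepInt B N (c i)) κ z) with hx_def
    have hxK : xVec B N S q Kf κ z = xVecOf B N S q (fun i => crepInt B N (c i)) κ z := by
      rw [xVec_eq_xVecOf]; simp only [hcrep]
    set bnd : ℝ := n * Real.sqrt m * β * σ / q with hbnd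
    have hσ0 : 0 ≤ σ := (norm_nonneg _).trans (hσ ⟨0, hn⟩)
    have hdvd : ∀ j, (q : ℤ) ∣ Az B N S q Kf κ z j := fun j => by
      rw [Az_eq_AzOf]; simp only [hcrep]; exact dvd_AzOf_of_mulVec_eq_zero c κ hAz j
    have hxL : x ∈ dualLat B := by rw [hx_def, ← hxK]; exact xVec_mem hS q Kf κ z
    have hznorm : ‖intVecToEuclidean m z‖ ≤ β := norm_intVec_le_of_sum_sq_le hβ hz
    have hxC : ‖x - ∑ i, (z i : ℝ) • ((rep B N (c i) : fineGrid n N) : EuclideanSpace ℝ (Fin n))‖ ≤ bnd := by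
      have h := norm_xVec_sub_le hB hS hli hq Kf κ z hdvd hσ
      rw [hxK] at h
      simp only [hcrep] at h
      rw [hx_def, show (fun i => (z i : ℝ) • ((rep B N (c i) : fineGrid n N) : EuclideanSpace ℝ (Fin n))) =
        fun i => (z i : ℝ) • ((N : ℝ)⁻¹ • intVecToEuclidean n (crepInt B N (c i))) from funext fun i => by rw [coe_rep_eq]]
      refine h.trans ?_
      rw [hbnd]
      gcongr
    have hT := htv z hzj
    have hηs' : 2 * smoothingParameter (dualLat B) ε ≤ 2 * r / (β * Real.sqrt (finrank ℝ (EuclideanSpace ℝ (Fin n)))) := by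
      rw [hfin]; exact hηs
    set P : PMF (Fin m → dualLat B) := indepLaw m fun i =>
      discreteGaussian (dualLat B) (2 * r / (β * Real.sqrt (finrank ℝ (EuclideanSpace ℝ (Fin n)))))
        (((rep B N (c i) : fineGrid n N) : EuclideanSpace ℝ (Fin n)) + fineGridVec n N (Tsh i)) with hP
    have hfail : (P.toOuterMeasure
        {y | bnd + r < ‖(x - ∑ i, (z i : ℝ) • ((y i : dualLat B) : EuclideanSpace ℝ (Fin n))) - t‖}).toReal ≤ 2 / 3 :=
      MicciancioRegev2007.toReal_indepLaw_lt_norm_output_sub_le (dualLat B) hε hε1 hβ hr (by rw [hfin]; exact hn) hηs'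
        (fun i => ((rep B N (c i) : fineGrid n N) : EuclideanSpace ℝ (Fin n))) (fun i => fineGridVec n N (Tsh i))
        hz hnum hxC hT
    have hcond : condLawD B N (2 * r / (β * Real.sqrt n)) Tsh c = P := by
      simp only [hP, condLawD, hfin]
      congr 1
      funext i
      rw [add_comm]
    rw [hcond]
    have hsub : {y : Fin m → dualLat B | bnd + r < ‖(x - ∑ i, (z i : ℝ) • ((y i : dualLat B) : EuclideanSpace ℝ (Fin n))) - t‖}ᶜ ⊆
        {y | queryMatrixD B N S q c κ = queryMatrixD B N S q c κ →
          (outputD B N S q (((c, κ), (queryMatrixD B N S q c κ, z)), y) ∈ dualLat B ∧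
            ‖outputD B N S q (((c, κ), (queryMatrixD B N S q c κ, z)), y) - t‖ ≤ n * Real.sqrt m * β * σ / q + r)} := by
      intro y hy _
      simp only [Set.mem_compl_iff, Set.mem_setOf_eq, not_lt] at hy
      have hout : outputD B N S q (((c, κ), (queryMatrixD B N S q c κ, z)), y) =
          x - ∑ i, (z i : ℝ) • ((y i : dualLat B) : EuclideanSpace ℝ (Fin n)) := rfl
      rw [hout]
      refine ⟨(dualLat B).sub_mem hxL (Submodule.sum_mem _ fun i _ => ?_), hy⟩
      rw [Int.cast_smul_eq_zsmul]
      exact (dualLat B).smul_mem (z i) (y i).2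
    calc (1 / 3 : ℝ) = 1 - 2 / 3 := by norm_num
      _ ≤ 1 - (P.toOuterMeasure {y | bnd + r < ‖(x - ∑ i, (z i : ℝ) • ((y i : dualLat B) : EuclideanSpace ℝ (Fin n))) - t‖}).toReal := by
          linarith
      _ = (P.toOuterMeasure {y | bnd + r < ‖(x - ∑ i, (z i : ℝ) • ((y i : dualLat B) : EuclideanSpace ℝ (Fin n))) - t‖}ᶜ).toReal :=
          (MicciancioRegev2007.toReal_toOuterMeasure_compl P _).symm
      _ ≤ _ := ENNReal.toReal_mono (PMF.toOuterMeasure_ne_top _ _)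
          (P.toOuterMeasure_mono (Set.inter_subset_left.trans hsub))
  · have hall : {y : Fin m → dualLat B | A = queryMatrixD B N S q c κ →
        (outputD B N S q (((c, κ), (A, z)), y) ∈ dualLat B ∧
          ‖outputD B N S q (((c, κ), (A, z)), y) - t‖ ≤ n * Real.sqrt m * β * σ / q + r)} = Set.univ :=
      Set.eq_univ_of_forall fun y h => (hA h).elim
    rw [hall, (PMF.toOuterMeasure_apply_eq_one_iff _ _).2 (Set.subset_univ _), ENNReal.toReal_one]
    norm_num

end Cond

/-! ### The success probability of one idealised attempt -/

section Main

variable (hB : B.det ≠ 0) (hS : ∀ j, intVecToEuclidean n (S j) ∈ dualLat B)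
  (hli : LinearIndependent ℝ fun j => intVecToEuclidean n (S j)) [NeZero (MM B N S)] [NeZero (Mo B N)]

include hS hli

omit hS hli [NeZero (MM B N S)] [NeZero (Mo B N)] in
/-- On the support of the experiment the recorded query is the true one. [folklore] -/
theorem queryD_eq_of_mem_support {q : ℕ} (O : Matrix (Fin n) (Fin m) (ZMod q) → PMF (Fin m → ℤ)) (s : ℝ)
    (Tsh : Fin m → Fin n → ℤ) (ℓ : ℕ)
    {ω : (((Fin m → Grp B N) × (Fin m → Fin n → ℤ)) × (Matrix (Fin n) (Fin m) (ZMod q) × (Fin m → ℤ))) × (Fin m → dualLat B)}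
    (hω : ω ∈ (experimentD B N S (q := q) hB O s Tsh ℓ).support) : ω.1.2.1 = queryMatrixD B N S q ω.1.1.1 ω.1.1.2 := by
  simp only [experimentD, PMF.support_bind, Set.mem_iUnion, PMF.support_map, Set.mem_image, PMF.support_pure,
    Set.mem_singleton_iff, exists_prop] at hω
  obtain ⟨ch, -, y, -, az, ⟨A, rfl, z, -, rfl⟩, rfl⟩ := hω
  rfl

/-- **MR07 Thm. 5.9 for one idealised attempt on the integer fine grid (fixed guess).** With
`δ = Pr_{A ∼ U, z ∼ O(A)}[A z ≡ 0, ∑zᵢ² ≤ β², z_{j₀} = α]`,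
`Pr[u ∈ Λ ∧ ‖u − t‖ ≤ n√m β σ/q + r] ≥ (δ − m·(2ε/(1+ε) + n·dT/2^ℓ + n·q/N))/3`.
[cite: MicciancioRegev2007, Thm. 5.9 (statement p. 22, proof pp. 22–24)] -/
theorem toReal_experimentD_success_ge {q : ℕ} [NeZero q] (hqN : q ≤ N)
    (O : Matrix (Fin n) (Fin m) (ZMod q) → PMF (Fin m → ℤ)) {ε β r σ : ℝ} (hε : 0 < ε) (hε1 : ε < 1)
    (hβ : 0 < β) (hr : 0 < r) (hn : 1 ≤ n)
    (hηs : 2 * smoothingParameter (dualLat B) ε ≤ 2 * r / (β * Real.sqrt n))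
    (hσ : ∀ j, ‖intVecToEuclidean n (S j)‖ ≤ σ) (Tsh : Fin m → Fin n → ℤ) (t : EuclideanSpace ℝ (Fin n))
    (j₀ : Fin m) (α : ℤ) (htv : ∀ z : Fin m → ℤ, z j₀ = α → ∑ i, (z i : ℝ) • fineGridVec n N (Tsh i) = -t)
    (hnum : 1 / (2 * π) + ε / (1 - ε) + (ε / (1 - ε)) ^ 2 * m ≤ 1 / 6) (ℓ : ℕ) :
    (1 / 3 : ℝ) *
        ((((PMF.uniformOfFintype (Matrix (Fin n) (Fin m) (ZMod q))).bind fun A =>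
            (O A).map (Prod.mk A)).toOuterMeasure
            {az | az.1.mulVec (fun i => (az.2 i : ZMod q)) = 0 ∧ ∑ i, (az.2 i : ℝ) ^ 2 ≤ β ^ 2 ∧ az.2 j₀ = α}).toReal -
          m * (2 * ε / (1 + ε) + n * (((dT B S).toNat : ℝ) / 2 ^ ℓ) + n * ((q : ℝ) / N))) ≤
      ((experimentD B N S hB O (2 * r / (β * Real.sqrt n)) Tsh ℓ).toOuterMeasure
        {ω | outputD B N S q ω ∈ dualLat B ∧ ‖outputD B N S q ω - t‖ ≤ n * Real.sqrt m * β * σ / q + r}).toReal := by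
  set s : ℝ := 2 * r / (β * Real.sqrt n) with hs_def
  have hsqrt : 0 < Real.sqrt n := Real.sqrt_pos.2 (by exact_mod_cast hn)
  have hs : 0 < s := by rw [hs_def]; positivity
  have hηs' : smoothingParameter (dualLat B) ε ≤ s := by
    have h0 := smoothingParameter_nonneg (dualLat B) ε
    rw [hs_def]; linarith
  have hq : 0 < q := Nat.pos_of_ne_zero (NeZero.ne q)
  have hskel := PMF.mul_sub_tvDist_le_toReal_experiment
    (((indepLaw m fun i => offsetLawD B N hB s (Tsh i)).bind fun c => (indepLaw m fun _ => boxLaw n ℓ).map (Prod.mk c)))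
    (fun ch => PMF.pure (queryMatrixD B N S q ch.1 ch.2)) O (fun ch => condLawD B N s Tsh ch.1)
    (PMF.uniformOfFintype (Matrix (Fin n) (Fin m) (ZMod q)))
    {az | az.1.mulVec (fun i => (az.2 i : ZMod q)) = 0 ∧ ∑ i, (az.2 i : ℝ) ^ 2 ≤ β ^ 2 ∧ az.2 j₀ = α}
    {ω | ω.1.2.1 = queryMatrixD B N S q ω.1.1.1 ω.1.1.2 →
      (outputD B N S q ω ∈ dualLat B ∧ ‖outputD B N S q ω - t‖ ≤ n * Real.sqrt m * β * σ / q + r)}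
    (θ := 1 / 3) (by norm_num)
    (fun ch az haz => cond_success_geD hB hS hli hq hε hε1 hβ hr hn hηs hσ Tsh t j₀ α htv hnum ch az haz)
  have hΔ := tvDist_queryD_le hB hS hli hqN hε hs hηs' Tsh ℓ
  have hmono : ((experimentD B N S hB O s Tsh ℓ).toOuterMeasure
      {ω | ω.1.2.1 = queryMatrixD B N S q ω.1.1.1 ω.1.1.2 →
        (outputD B N S q ω ∈ dualLat B ∧ ‖outputD B N S q ω - t‖ ≤ n * Real.sqrt m * β * σ / q + r)}).toReal ≤
      ((experimentD B N S hB O s Tsh ℓ).toOuterMeasure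
        {ω | outputD B N S q ω ∈ dualLat B ∧ ‖outputD B N S q ω - t‖ ≤ n * Real.sqrt m * β * σ / q + r}).toReal :=
    ENNReal.toReal_mono (PMF.toOuterMeasure_ne_top _ _) (PMF.toOuterMeasure_mono _
      fun ω hω => hω.1 (queryD_eq_of_mem_support hB O s Tsh ℓ hω.2))
  have hexp : (((indepLaw m fun i => offsetLawD B N hB s (Tsh i)).bind fun c =>
      (indepLaw m fun _ => boxLaw n ℓ).map (Prod.mk c)).bind fun ch => (condLawD B N s Tsh ch.1).bind fun y =>
        ((PMF.pure (queryMatrixD B N S q ch.1 ch.2)).bind fun A => (O A).map (Prod.mk A)).map fun az => ((ch, az), y)) =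
      experimentD B N S hB O s Tsh ℓ := rfl
  rw [hexp] at hskel
  refine le_trans ?_ (hskel.trans hmono)
  exact mul_le_mul_of_nonneg_left (sub_le_sub_left hΔ _) (by norm_num)

end Main

/-! ### The attempt in sampling order: the natural experiment of the machine -/

section Natural

variable (B N S)

/-- The law of a noise vector `K = X + T` with iid coordinates `Xₗ ∼ D` (any one-dimensional law `D`:
the exact `D_{ℤ, N s, 0}` in the analysis, the machine's sampler in the run). [folklore] -/
def gridNoiseWith (D : PMF ℤ) (T : Fin n → ℤ) : PMF (Fin n → ℤ) := (indepLaw n fun _ => D).map (· + T)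

/-- **The law of the grid noise `Kᵢ = Xᵢ + Tᵢ`** (grid units): `Xᵢ ∼ ⨂ₗ D_{ℤ, N s, 0}`.
[cite: MicciancioRegev2007, Lemma 5.7 (fine-grid form)] -/
def gridNoise (s : ℝ) (T : Fin n → ℤ) : PMF (Fin n → ℤ) := gridNoiseWith (discreteGaussianInt ((N : ℝ) * s) 0) T

/-- **The query matrix computed by the machine** from the noises and boxes. [cite: MicciancioRegev2007, Lemma 5.8 (step 3)] -/
def Amat (q : ℕ) (K κ : Fin m → Fin n → ℤ) : Matrix (Fin n) (Fin m) (ZMod q) :=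
  Matrix.of fun j i => ((aEnt B N S q (K i) (κ i) j : ℤ) : ZMod q)

/-- **One attempt in sampling order with an arbitrary one-dimensional sampler law `D`**: noises,
boxes, query, oracle, `u = uVec`. [cite: MicciancioRegev2007, Thm. 5.9 (steps 2–4)] -/
def naturalAttemptWith {q : ℕ} (D : PMF ℤ) (O : Matrix (Fin n) (Fin m) (ZMod q) → PMF (Fin m → ℤ))
    (Tsh : Fin m → Fin n → ℤ) (ℓ : ℕ) : PMF (Fin n → ℤ) :=
  (indepLaw m fun i => gridNoiseWith D (Tsh i)).bind fun K =>
    (indepLaw m fun _ => boxLaw n ℓ).bind fun κ => (O (Amat B N S q K κ)).map fun z => uVec B N S q K κ z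

/-- **The natural (sampling-order) idealised attempt** (`D = D_{ℤ, N s, 0}`).
[cite: MicciancioRegev2007, Thm. 5.9 (steps 2–4)] -/
def naturalAttempt {q : ℕ} (O : Matrix (Fin n) (Fin m) (ZMod q) → PMF (Fin m → ℤ)) (s : ℝ) (Tsh : Fin m → Fin n → ℤ)
    (ℓ : ℕ) : PMF (Fin n → ℤ) :=
  naturalAttemptWith B N S (discreteGaussianInt ((N : ℝ) * s) 0) O Tsh ℓ

variable {B N S}

/-- `reduceVec (liftVec [v]) = reduceVec v`: the reduced representative of the class of `v`. [folklore] -/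
theorem crepInt_mk (hB : B.det ≠ 0) (v : Fin n → ℤ) :
    crepInt B N (QuotientAddGroup.mk' (Hsub B N) (castVec B N v)) = reduceVec B N v := by
  have h := rep_phi (N := N) hB v
  rw [phi_fineGridEquiv, rep_eq_fineGridEquiv_crepInt] at h
  exact (fineGridEquiv n N).injective h

/-- The pairs `(cᵢ, yᵢ)` of the sampling procedure as a function of the noise. [folklore] -/
def gsOf (hB : B.det ≠ 0) (K : Fin n → ℤ) : Grp B N × dualLat B :=
  MicciancioRegev2007.gridSample (phi B N) (hker hB) (rep B N) (phi_rep hB) (fineGridEquiv n N K)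

/-- `crep K = crepInt c` for the class `c` produced from the noise `K`. [folklore] -/
theorem crepInt_gsOf_fst (hB : B.det ≠ 0) (K : Fin n → ℤ) : crepInt B N (gsOf (N := N) hB K).1 = crep B N K := by
  rw [gsOf, gridSample_fst_eq hB, crepInt_mk hB, crep]

/-- `y = yVec K` for the lattice vector produced from the noise `K`. [folklore] -/
theorem coe_gsOf_snd (hB : B.det ≠ 0) (K : Fin n → ℤ) :
    ((gsOf (N := N) hB K).2 : EuclideanSpace ℝ (Fin n)) = intVecToEuclidean n (yVec B N K) := by
  rw [gsOf, coe_gridSample_snd_eq hB]; rfl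

/-- The machine's query is the query of the classes. [folklore] -/
theorem Amat_eq_queryMatrixD (hB : B.det ≠ 0) (q : ℕ) (K κ : Fin m → Fin n → ℤ) :
    Amat B N S q K κ = queryMatrixD B N S q (fun i => (gsOf (N := N) hB (K i)).1) κ := by
  ext j i
  simp only [Amat, queryMatrixD, Matrix.of_apply, crepInt_gsOf_fst hB, aEnt_eq_aEntOf]

/-- The machine's `u` is `outputD` of the corresponding value of the experiment. [folklore] -/
theorem coe_uVec_eq_outputD (hB : B.det ≠ 0) (q : ℕ) (K κ : Fin m → Fin n → ℤ) (A : Matrix (Fin n) (Fin m) (ZMod q))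
    (z : Fin m → ℤ) :
    intVecToEuclidean n (uVec B N S q K κ z) =
      outputD B N S q ((((fun i => (gsOf (N := N) hB (K i)).1), κ), (A, z)), fun i => (gsOf (N := N) hB (K i)).2) := by
  rw [coe_uVec_eq, outputD, xVec_eq_xVecOf]
  dsimp only
  simp only [crepInt_gsOf_fst hB, coe_gsOf_snd hB]

/-- The grid Gaussian through the sampling procedure, from the integer noise. [folklore] -/
theorem map_gsOf_gridNoise (hB : B.det ≠ 0) {s : ℝ} (hs : 0 < s) (T : Fin n → ℤ) :
    (gridNoise N s T).map (gsOf (N := N) hB) =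
      (discreteGaussian (fineGrid n N) s (fineGridVec n N T)).map
        (MicciancioRegev2007.gridSample (phi B N) (hker hB) (rep B N) (phi_rep hB)) := by
  rw [discreteGaussian_fineGrid_fineGridVec_eq_map hs, PMF.map_comp, gridNoise, gridNoiseWith]
  rfl

/-- **Lemma 5.7 (second claim) for all runs**: the pairs from independent noises are
`(⨂ offsetLawD) ⋉ condLawD`, zipped. [cite: MicciancioRegev2007, Lemma 5.7 (second claim)] -/
theorem indepLaw_map_gsOf_eq (hB : B.det ≠ 0) {s : ℝ} (hs : 0 < s) (Tsh : Fin m → Fin n → ℤ) :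
    (indepLaw m fun i => (gridNoise N s (Tsh i)).map (gsOf (N := N) hB)) =
      (indepLaw m fun i => offsetLawD B N hB s (Tsh i)).bind fun c =>
        (condLawD B N s Tsh c).map fun y i => (c i, y i) := by
  have hfac : ∀ i, (gridNoise N s (Tsh i)).map (gsOf (N := N) hB) =
      (offsetLawD B N hB s (Tsh i)).bind fun a =>
        (discreteGaussian (dualLat B) s (fineGridVec n N (Tsh i) + ((rep B N a : fineGrid n N) : EuclideanSpace ℝ (Fin n)))).map
          (Prod.mk a) := by
    intro i
    rw [map_gsOf_gridNoise hB hs, MicciancioRegev2007.map_gridSample_eq_bind dualLat_le_fineGrid _ _ (rep B N) (phi_rep hB) hs]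
    congr 1
    rw [offsetLawD, PMF.map_comp]
    rfl
  simp_rw [hfac]
  exact indepLaw_bind_map_prodMk m _ (fun i a => discreteGaussian (dualLat B) s
    (fineGridVec n N (Tsh i) + ((rep B N a : fineGrid n N) : EuclideanSpace ℝ (Fin n))))

/-- **The natural attempt is the idealised experiment read through `outputD`** (as laws on `ℝⁿ`).
[cite: MicciancioRegev2007, Thm. 5.9 (proof, steps 2–4 and Figure 2)] -/
theorem map_naturalAttempt_eq (hB : B.det ≠ 0) {q : ℕ} (O : Matrix (Fin n) (Fin m) (ZMod q) → PMF (Fin m → ℤ)) {s : ℝ}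
    (hs : 0 < s) (Tsh : Fin m → Fin n → ℤ) (ℓ : ℕ) :
    (naturalAttempt B N S O s Tsh ℓ).map (intVecToEuclidean n) = (experimentD B N S hB O s Tsh ℓ).map (outputD B N S q) := by
  -- Step 1: the natural attempt through the pairs `(cᵢ, yᵢ)`
  have h1 : (naturalAttempt B N S O s Tsh ℓ).map (intVecToEuclidean n) =
      ((indepLaw m fun i => (gridNoise N s (Tsh i)).map (gsOf (N := N) hB)).bind fun cy =>
        (indepLaw m fun _ => boxLaw n ℓ).bind fun κ =>
          (O (queryMatrixD B N S q (fun i => (cy i).1) κ)).map fun z =>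
            ((((fun i => (cy i).1), κ), (queryMatrixD B N S q (fun i => (cy i).1) κ, z)), fun i => (cy i).2)).map
        (outputD B N S q) := by
    rw [← indepLaw_map_pi m _ (fun _ => gsOf (N := N) hB), PMF.bind_map, PMF.map_bind, naturalAttempt, naturalAttemptWith,
      PMF.map_bind]
    refine congrArg (indepLaw m fun i => gridNoise N s (Tsh i)).bind (funext fun K => ?_)
    simp only [Function.comp_apply, PMF.map_bind]
    refine congrArg (indepLaw m fun _ => boxLaw n ℓ).bind (funext fun κ => ?_)
    rw [PMF.map_comp, PMF.map_comp, ← Amat_eq_queryMatrixD hB]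
    congr 1
    funext z
    simp only [Function.comp_apply]
    exact coe_uVec_eq_outputD hB q K κ _ z
  rw [h1, indepLaw_map_gsOf_eq hB hs Tsh, PMF.bind_bind, experimentD, PMF.bind_bind, PMF.map_bind, PMF.map_bind]
  refine congrArg (indepLaw m fun i => offsetLawD B N hB s (Tsh i)).bind (funext fun c => ?_)
  rw [PMF.bind_map, PMF.bind_map]
  change (((condLawD B N s Tsh c).bind fun y => (indepLaw m fun _ => boxLaw n ℓ).bind fun κ =>
      (O (queryMatrixD B N S q c κ)).map fun z => (((c, κ), (queryMatrixD B N S q c κ, z)), y)).map (outputD B N S q)) =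
    ((indepLaw m fun _ => boxLaw n ℓ).bind fun κ => (condLawD B N s Tsh c).bind fun y =>
      ((PMF.pure (queryMatrixD B N S q c κ)).bind fun A => (O A).map (Prod.mk A)).map fun az => (((c, κ), az), y)).map
      (outputD B N S q)
  rw [PMF.bind_comm]
  congr 1
  refine congrArg (indepLaw m fun _ => boxLaw n ℓ).bind (funext fun κ => ?_)
  refine congrArg (condLawD B N s Tsh c).bind (funext fun y => ?_)
  rw [PMF.pure_bind, PMF.map_comp]
  rfl

/-- **MR07 Thm. 5.9 for one idealised attempt in sampling order**: the machine-shaped experiment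
`naturalAttempt` (noises → boxes → query → oracle → `u = uVec`) outputs, with probability at least
`(δ − m·(2ε/(1+ε) + n·dT/2^ℓ + n·q/N))/3`, an integer vector `u ∈ Λ` with `‖u − t‖ ≤ n√m β σ/q + r`.
[cite: MicciancioRegev2007, Thm. 5.9] -/
theorem toReal_naturalAttempt_success_ge (hB : B.det ≠ 0) (hS : ∀ j, intVecToEuclidean n (S j) ∈ dualLat B)
    (hli : LinearIndependent ℝ fun j => intVecToEuclidean n (S j)) [NeZero (MM B N S)] [NeZero (Mo B N)]
    {q : ℕ} [NeZero q] (hqN : q ≤ N) (O : Matrix (Fin n) (Fin m) (ZMod q) → PMF (Fin m → ℤ)) {ε β r σ : ℝ}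
    (hε : 0 < ε) (hε1 : ε < 1) (hβ : 0 < β) (hr : 0 < r) (hn : 1 ≤ n)
    (hηs : 2 * smoothingParameter (dualLat B) ε ≤ 2 * r / (β * Real.sqrt n))
    (hσ : ∀ j, ‖intVecToEuclidean n (S j)‖ ≤ σ) (Tsh : Fin m → Fin n → ℤ) (t : EuclideanSpace ℝ (Fin n))
    (j₀ : Fin m) (α : ℤ) (htv : ∀ z : Fin m → ℤ, z j₀ = α → ∑ i, (z i : ℝ) • fineGridVec n N (Tsh i) = -t)
    (hnum : 1 / (2 * π) + ε / (1 - ε) + (ε / (1 - ε)) ^ 2 * m ≤ 1 / 6) (ℓ : ℕ) :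
    (1 / 3 : ℝ) *
        ((((PMF.uniformOfFintype (Matrix (Fin n) (Fin m) (ZMod q))).bind fun A =>
            (O A).map (Prod.mk A)).toOuterMeasure
            {az | az.1.mulVec (fun i => (az.2 i : ZMod q)) = 0 ∧ ∑ i, (az.2 i : ℝ) ^ 2 ≤ β ^ 2 ∧ az.2 j₀ = α}).toReal -
          m * (2 * ε / (1 + ε) + n * (((dT B S).toNat : ℝ) / 2 ^ ℓ) + n * ((q : ℝ) / N))) ≤
      ((naturalAttempt B N S O (2 * r / (β * Real.sqrt n)) Tsh ℓ).toOuterMeasure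
        {u | intVecToEuclidean n u ∈ dualLat B ∧ ‖intVecToEuclidean n u - t‖ ≤ n * Real.sqrt m * β * σ / q + r}).toReal := by
  have hsqrt : 0 < Real.sqrt n := Real.sqrt_pos.2 (by exact_mod_cast hn)
  have hs : 0 < 2 * r / (β * Real.sqrt n) := by positivity
  refine (toReal_experimentD_success_ge hB hS hli hqN O hε hε1 hβ hr hn hηs hσ Tsh t j₀ α htv hnum ℓ).trans ?_
  have hpre : {u : Fin n → ℤ | intVecToEuclidean n u ∈ dualLat B ∧ ‖intVecToEuclidean n u - t‖ ≤ n * Real.sqrt m * β * σ / q + r} =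
      intVecToEuclidean n ⁻¹' {v | v ∈ dualLat B ∧ ‖v - t‖ ≤ n * Real.sqrt m * β * σ / q + r} := rfl
  rw [hpre, ← PMF.toOuterMeasure_map_apply, map_naturalAttempt_eq hB O hs Tsh ℓ, PMF.toOuterMeasure_map_apply]
  exact ENNReal.toReal_mono (PMF.toOuterMeasure_ne_top _ _) (PMF.toOuterMeasure_mono _ fun ω hω => hω.1)

end Natural

end DualGrid

end Literature.Algebra.EuclideanLattices

end
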